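import Mathlib
import Literature.AlgebraicGeometry.Resolution.CobordantGame
import Literature.AlgebraicGeometry.Resolution.CobordantChartOneMove
import Summits.ResolutionOfSingularities.ResolutionOfSingularities.Theorems.WeightedInvariantLocalWeightedDropG5Won
import Summits.ResolutionOfSingularities.ResolutionOfSingularities.Theorems.WeightedInvariantLocalWeightedDropFD1MoveOne

/-!
# `WeightedInvariant.LocalWeightedDrop`: the REFUTE-L1 specimen FD-1 is WON in two moves (§4 R2-1)

Route `ResolutionOfSingularities/WeightedInvariant`, crux `LocalWeightedDrop`
(stmt-ResolutionOfSingularities-8899).  [OURS · L1 W4.3] — §4 R2-1 `won_FD1` of ideator res-L1-w43-idea-1's `Sketch-L1-idea-1.lean`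
(v4): card A WINS the tri-2 TESTBANK specimen FD-1 `z⁴ + (x₀+ξ)²y⁴ + s y⁵` (`0 = ξ, 1 = y, 2 = z, 3 = s`) at a point of its twisted
line, in TWO moves, over EVERY field of characteristic `2` and for EVERY `x₀` (the sketch's `[IsAlgClosed k]` and `x₀ ≠ 0` are not
needed).  Nothing here is a statement of the manuscript under review on ladder RESOLUTION; AI-produced, weaker than expert review.

MOVE TWO.  By `…FD1MoveOne` the singular successors of the first move `(X, (0,1,1,0))` are
`G = (c₂+z)⁴ + (x₀+ξ)²(c₁+y)⁴ + t·s·(c₁+y)⁵ ∈ k⟦t, ξ, y, z, s⟧` with `c₁ ≠ 0`, `c₂² = x₀c₁²`.  In characteristic `2`,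
`(c₂+z)⁴ + (x₀+ξ)²(c₁+y)⁴ = W²` with `W = (c₂+z)² + (x₀+ξ)(c₁+y)² = z² + x₀y² + ξ(c₁+y)²` (the constants cancel by `c₂² = x₀c₁²`),
whose linear part is `c₁²·ξ`; the legal formal coordinate change
`θ₂ : ξ ↦ ρ²·(ξ + z² + x₀y²),  s ↦ ρ⁵·s` (`ρ = (c₁ + y)⁻¹ ∈ k⟦y⟧`, identity on `t, y, z`) gives EXACTLY
`G ∘ θ₂ = ξ² + t·s` (`exists_moveTwo_fd1Successor`), which is `(t:1, ξ:1, s:1)`-homogeneous of degree `2` with cone smooth off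
the vertex directions: the sketch's «`V(W,s,t)` weights `(1,1,1)`: no singular successor».
-/

set_option linter.dupNamespace false -- mandated namespace of this single-conjunct summit
set_option autoImplicit false

namespace Summit.ResolutionOfSingularities.ResolutionOfSingularities.Theorems

namespace GradedGame

open MvPowerSeries
open Literature.AlgebraicGeometry.Resolution
open Literature.AlgebraicGeometry.Resolution.CobordantChart

variable {k : Type} [Field k]

section MoveTwo

variable [CharP k 2] (x₀ c₁ c₂ : k) (hc₁ : c₁ ≠ 0) (hrel : c₂ ^ 2 = x₀ * c₁ ^ 2)
include hc₁ hrel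

/-- MOVE TWO on the FD-1 successor: a legal move `(θ₂, w₂ = (1,1,0,0,1))` with `G ∘ θ₂ = ξ² + t·s` exactly. [OURS · L1 W4.3] -/
theorem exists_moveTwo_fd1Successor :
    ∃ θ : Fin 5 → MvPowerSeries (Fin 5) k, CobordantGame.IsMove k θ ![1, 1, 0, 0, 1] ∧
      subst θ ((C c₂ + X 3) ^ 4 + (C x₀ + X 1) ^ 2 * (C c₁ + X 2) ^ 4 + X 0 * X 4 * (C c₁ + X 2) ^ 5 :
        MvPowerSeries (Fin 5) k) = X 1 ^ 2 + X 0 * X 4 := by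
  classical
  haveI : CharP (MvPowerSeries (Fin 5) k) 2 := charP_of_injective_ringHom C_injective 2
  have h2 : (2 : MvPowerSeries (Fin 5) k) = 0 := CharP.ofNat_eq_zero _ 2
  -- `ρ = (c₁ + y)⁻¹ ∈ k⟦y⟧`, embedded along `y = X 2`
  set q₁ : PowerSeries k := PowerSeries.C c₁ + PowerSeries.X with hq₁
  have hq₁0 : PowerSeries.constantCoeff q₁ = c₁ := by simp [hq₁]
  set ρ : MvPowerSeries (Fin 5) k := embAt 2 q₁⁻¹ with hρ
  have hqρ : (C c₁ + X 2) * ρ = 1 := by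
    have : embAt 2 q₁ = (C c₁ + X 2 : MvPowerSeries (Fin 5) k) := by rw [hq₁, embAt_add, embAt_C, embAt_X]
    rw [← this, hρ, ← embAt_mul, PowerSeries.mul_inv_cancel q₁ (by rw [hq₁0]; exact hc₁), embAt_one]
  have hcρ : constantCoeff ρ = c₁⁻¹ := by
    rw [hρ, constantCoeff_embAt, PowerSeries.constantCoeff_inv, hq₁0]
  -- the move
  set θ : Fin 5 → MvPowerSeries (Fin 5) k :=
    ![X 0, ρ ^ 2 * X 1 + ρ ^ 2 * X 3 * X 3 + C x₀ * ρ ^ 2 * X 2 * X 2, X 2, X 3, ρ ^ 5 * X 4] with hθ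
  have hθ0 : θ 0 = X 0 := rfl
  have hθ1 : θ 1 = ρ ^ 2 * X 1 + ρ ^ 2 * X 3 * X 3 + C x₀ * ρ ^ 2 * X 2 * X 2 := rfl
  have hθ2 : θ 2 = X 2 := rfl
  have hθ3 : θ 3 = X 3 := rfl
  have hθ4 : θ 4 = ρ ^ 5 * X 4 := rfl
  have hθcc : ∀ i, constantCoeff (θ i) = 0 := by
    intro i
    fin_cases i
    · simp [hθ0, constantCoeff_X]
    · simp [hθ1, constantCoeff_X]
    · simp [hθ2, constantCoeff_X]
    · simp [hθ3, constantCoeff_X]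
    · simp [hθ4, constantCoeff_X]
  have hθs : HasSubst θ := hasSubst_of_constantCoeff_zero hθcc
  refine ⟨θ, ⟨hθcc, ?_, ⟨0, by simp⟩⟩, ?_⟩
  · -- linear part `diag(1, c₁⁻², 1, 1, c₁⁻⁵)`
    have hXX : ∀ j a : Fin 5, coeff (Finsupp.single j 1) (X a : MvPowerSeries (Fin 5) k) =
        if j = a then 1 else 0 := fun j a => by
      rw [coeff_X]
      by_cases h : j = a
      · subst h; simp
      · rw [if_neg, if_neg h]
        exact fun h' => h ((Finsupp.single_left_inj one_ne_zero).mp h')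
    have hr0 : ∀ j : Fin 5, coeff (Finsupp.single j 1) (θ 0) = if j = 0 then 1 else 0 := fun j => by rw [hθ0, hXX]
    have hr1 : ∀ j : Fin 5, coeff (Finsupp.single j 1) (θ 1) = if j = 1 then c₁⁻¹ ^ 2 else 0 := fun j => by
      rw [hθ1, map_add, map_add, coeff_single_one_mul_X,
        coeff_single_one_mul_eq_zero _ _ (by simp [constantCoeff_X]) (constantCoeff_X _),
        coeff_single_one_mul_eq_zero _ _ (by simp [constantCoeff_X]) (constantCoeff_X _), add_zero, add_zero]
      simp [hcρ]
    have hr2 : ∀ j : Fin 5, coeff (Finsupp.single j 1) (θ 2) = if j = 2 then 1 else 0 := fun j => by rw [hθ2, hXX]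
    have hr3 : ∀ j : Fin 5, coeff (Finsupp.single j 1) (θ 3) = if j = 3 then 1 else 0 := fun j => by rw [hθ3, hXX]
    have hr4 : ∀ j : Fin 5, coeff (Finsupp.single j 1) (θ 4) = if j = 4 then c₁⁻¹ ^ 5 else 0 := fun j => by
      rw [hθ4, coeff_single_one_mul_X]
      simp [hcρ]
    have hM : (Matrix.of fun i j : Fin 5 => coeff (Finsupp.single j 1) (θ i)) =
        Matrix.diagonal ![(1 : k), c₁⁻¹ ^ 2, 1, 1, c₁⁻¹ ^ 5] := by
      ext i j
      rw [Matrix.of_apply, Matrix.diagonal_apply]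
      fin_cases i
      · fin_cases j <;> simp [hr0]
      · fin_cases j <;> simp [hr1]
      · fin_cases j <;> simp [hr2]
      · fin_cases j <;> simp [hr3]
      · fin_cases j <;> simp [hr4]
    rw [hM, Matrix.det_diagonal]
    simp [Fin.prod_univ_succ, hc₁]
  · -- the identity
    simp only [subst_add hθs, subst_mul hθs, subst_pow hθs, subst_X hθs, subst_C]
    rw [hθ0, hθ1, hθ2, hθ3, hθ4]
    set t : MvPowerSeries (Fin 5) k := X 0
    set xi : MvPowerSeries (Fin 5) k := X 1
    set y : MvPowerSeries (Fin 5) k := X 2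
    set z : MvPowerSeries (Fin 5) k := X 3
    set s : MvPowerSeries (Fin 5) k := X 4
    set a : MvPowerSeries (Fin 5) k := C c₁
    set b : MvPowerSeries (Fin 5) k := C c₂
    set x : MvPowerSeries (Fin 5) k := C x₀
    have hc : b ^ 2 = x * a ^ 2 := by
      simp only [a, b, x, ← map_pow, ← map_mul, hrel]
    -- (1) the `s`-term: `t · ρ⁵ s · (a + y)⁵ = t s`
    have hT : t * (ρ ^ 5 * s) * (a + y) ^ 5 = t * s := by
      linear_combination (t * s * (((a + y) * ρ) ^ 4 + ((a + y) * ρ) ^ 3 + ((a + y) * ρ) ^ 2 + (a + y) * ρ + 1)) * hqρ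
    -- (2) the twisted coordinate: `(x + θ₁)(a + y)² = x (a + y)² + (ξ + z² + x y²)`
    have hM : (x + (ρ ^ 2 * xi + ρ ^ 2 * z * z + x * ρ ^ 2 * y * y)) * (a + y) ^ 2 =
        x * (a + y) ^ 2 + (xi + z * z + x * y * y) := by
      linear_combination ((xi + z * z + x * y * y) * ((a + y) * ρ + 1)) * hqρ
    calc (b + z) ^ 4 + (x + (ρ ^ 2 * xi + ρ ^ 2 * z * z + x * ρ ^ 2 * y * y)) ^ 2 * (a + y) ^ 4
          + t * (ρ ^ 5 * s) * (a + y) ^ 5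
        = (b + z) ^ 4 + ((x + (ρ ^ 2 * xi + ρ ^ 2 * z * z + x * ρ ^ 2 * y * y)) * (a + y) ^ 2) ^ 2
          + t * (ρ ^ 5 * s) * (a + y) ^ 5 := by ring
      _ = (b + z) ^ 4 + (x * (a + y) ^ 2 + (xi + z * z + x * y * y)) ^ 2 + t * s := by rw [hM, hT]
      _ = xi ^ 2 + t * s := by
          linear_combination (a ^ 2 * b ^ 2 * x + 2 * z * b ^ 3 + 3 * z ^ 2 * b ^ 2 + z ^ 2 * a ^ 2 * x + 2 * z ^ 3 * b
            + z ^ 4 + 2 * y * a ^ 3 * x ^ 2 + 2 * y * z ^ 2 * a * x + 4 * y ^ 2 * a ^ 2 * x ^ 2 + 2 * y ^ 2 * z ^ 2 * x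
            + 4 * y ^ 3 * a * x ^ 2 + 2 * y ^ 4 * x ^ 2 + xi * a ^ 2 * x + xi * z ^ 2 + 2 * xi * y * a * x
            + 2 * xi * y ^ 2 * x) * h2 + (b ^ 2 - x * a ^ 2) * hc

/-- THE SINGULAR FIRST-MOVE SUCCESSORS OF FD-1 ARE WON IN ONE MORE MOVE. [OURS · L1 W4.3] -/
theorem won_fd1Successor :
    CobordantGame.Won k 5 ((C c₂ + X 3) ^ 4 + (C x₀ + X 1) ^ 2 * (C c₁ + X 2) ^ 4 + X 0 * X 4 * (C c₁ + X 2) ^ 5 :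
      MvPowerSeries (Fin 5) k) := by
  classical
  obtain ⟨θ, hmove, hθ⟩ := exists_moveTwo_fd1Successor x₀ c₁ c₂ hc₁ hrel
  set w : Fin 5 → ℕ := ![1, 1, 0, 0, 1] with hw
  set P : MvPolynomial (Fin 5) k := MvPolynomial.X 1 ^ 2 + MvPolynomial.X 0 * MvPolynomial.X 4 with hPdef
  have hcoe : (P : MvPowerSeries (Fin 5) k) = X 1 ^ 2 + X 0 * X 4 := by
    simp [hPdef, MvPolynomial.coe_add, MvPolynomial.coe_mul, MvPolynomial.coe_pow, MvPolynomial.coe_X]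
  have hw0 : w 0 = 1 := rfl
  have hw1 : w 1 = 1 := rfl
  have hw4 : w 4 = 1 := rfl
  have hP : P.IsWeightedHomogeneous w 2 := by
    have h0 := MvPolynomial.isWeightedHomogeneous_X (R := k) w 0
    have h1 := MvPolynomial.isWeightedHomogeneous_X (R := k) w 1
    have h4 := MvPolynomial.isWeightedHomogeneous_X (R := k) w 4
    rw [hw0] at h0; rw [hw1] at h1; rw [hw4] at h4
    have hA : (MvPolynomial.X 1 ^ 2 : MvPolynomial (Fin 5) k).IsWeightedHomogeneous w (2 • 1) := h1.pow 2
    have hB : (MvPolynomial.X 0 * MvPolynomial.X 4 : MvPolynomial (Fin 5) k).IsWeightedHomogeneous w (1 + 1) := h0.mul h4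
    have e1 : (2 • 1 : ℕ) = 2 := rfl
    rw [e1] at hA
    rw [hPdef]
    exact hA.add hB
  have hP0 : P ≠ 0 := by
    intro h0
    have := congrArg (fun Q : MvPolynomial (Fin 5) k => (Q : MvPowerSeries (Fin 5) k)) h0
    simp only [hcoe, MvPolynomial.coe_zero] at this
    have h2 := congrArg (coeff (Finsupp.single (1 : Fin 5) 2)) this
    rw [map_add, coeff_X_pow, if_pos rfl, X_dvd_iff.mp (dvd_mul_right (X 0 : MvPowerSeries (Fin 5) k) _) _ (by simp),
      map_zero] at h2
    simp at h2
  have hcone : ∀ c : Fin 5 → k, (∀ i, w i = 0 → c i = 0) → MvPolynomial.eval c P = 0 →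
      (∀ i, MvPolynomial.eval c (MvPolynomial.pderiv i P) = 0) → c = 0 := by
    intro c hc0 hPc hD
    have hc4 : c 4 = 0 := by
      have := hD 0
      rw [hPdef] at this
      simpa [Derivation.leibniz, Derivation.leibniz_pow, MvPolynomial.pderiv_X, Pi.single_apply] using this
    have hc0' : c 0 = 0 := by
      have := hD 4
      rw [hPdef] at this
      simpa [Derivation.leibniz, Derivation.leibniz_pow, MvPolynomial.pderiv_X, Pi.single_apply] using this
    have hc1 : c 1 = 0 := by
      rw [hPdef] at hPc
      simpa [hc4] using hPc
    funext i
    fin_cases i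
    · exact hc0'
    · exact hc1
    · exact hc0 2 rfl
    · exact hc0 3 rfl
    · exact hc4
  refine CobordantGame.Won.move θ w hmove fun g hg => ?_
  obtain ⟨c, e, hoff, hfac, hndvd, hsing⟩ := hg
  rw [hθ, ← hcoe] at hfac
  have hfac' : subst (fun i : Fin 5 => if 0 < w i then
      X (0 : Fin (5 + 1)) ^ (w i) * (C (c i) + X i.succ) else X i.succ)
      (subst (X : Fin 5 → MvPowerSeries (Fin 5) k) (P : MvPowerSeries (Fin 5) k)) = X 0 ^ e * g := by
    rw [MvPowerSeries.subst_self]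
    exact hfac
  exact absurd hsing (crux_move_wins_of_isWeightedHomogeneous_offVertex w hP hP0 hcone c hoff e g hfac' hndvd)

end MoveTwo

/-- §4 R2-1 — CARD A WINS FD-1 IN TWO MOVES: the REFUTE-L1 specimen `z⁴ + (x₀+ξ)²y⁴ + s y⁵` (`0 = ξ, 1 = y, 2 = z, 3 = s`) at a
point of its twisted line is WON — centre `V(z, y)` (weights `(0,1,1,0)`), then on each singular successor the move
`V(W, s, t)` with weights `(1,1,1)` after the characteristic-2 coordinate change of `exists_moveTwo_fd1Successor`.  Char `2`,
every field, every `x₀` (the sketch's `[IsAlgClosed k]` and `x₀ ≠ 0` are not used). [OURS · L1 W4.3, Sketch-L1-idea-1 v4 §4 R2-1] -/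
theorem won_FD1 [CharP k 2] (x₀ : k) :
    CobordantGame.Won k 4 (X 2 ^ 4 + (C x₀ + X 0) ^ 2 * X 1 ^ 4 + X 3 * X 1 ^ 5 : MvPowerSeries (Fin 4) k) := by
  refine CobordantGame.Won.move MvPowerSeries.X ![0, 1, 1, 0] (isMove_X _ ⟨1, by simp⟩) fun g hg => ?_
  obtain ⟨c₁, c₂, hc₁, hrel, rfl⟩ := fd1_isSuccessor_classification x₀ g hg
  exact won_fd1Successor x₀ c₁ c₂ hc₁ hrel

end GradedGame

end Summit.ResolutionOfSingularities.ResolutionOfSingularities.Theorems
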